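import Summits.Ventures.GridStability.Models.AngleEnclosure
import Summits.Ventures.GridStability.Models.RelativeSwingLFFLines
import Summits.Ventures.GridStability.Models.RecastAngles

/-!
# GridStability/Models/LineAngleBounds — certified rational enclosures of equilibrium LINE angles and
# the two rational bounds an explicit Vu–Turitsyn level needs (generic over `RecastData`)

Cell `gridfusion` (LADDER-GRIDFUSION, LFF lane P1/P2 «explicit rational level»), seat gridfusion-model-1
(g4). lyap-1's certified synchronisation regions `Lyapunov/WSCC9LffRoa.lean` (p487113),
`Lyapunov/NE39LLffRoa.lean` (p488432) and the oso instance keep the level SYMBOLIC: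
`c₀ < V(0) + K_k · vtGap(δ*_k)` for every line `k`, with `V(0) = −Σ_k K_k (cos δ*_k + δ*_k sin δ*_k)`
(lit-6 `Certificate.V_zero`) and `vtGap d = 2 cos d − (π − 2|d|) sin |d|` — both contain the irrational
LINE ANGLES `δ*_k = θ*_a − θ*_b` (differences of `angleOf`, themselves `± arccos c_i` of exact rational
circle points) and `π`. This file turns them into RATIONAL data, generically for every `d : RecastData n`
with acute exact circle points (`s_i² + c_i² = 1`, `c_i > 0`, `s_i ≥ 0` where a lower bound is wanted):

* per machine (`RecastData.angleOf_gt_of_chain5` / `angleOf_lt_of_chain`): the `AngleEnclosure` chains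
  (p482834) read on `cos (angleOf i) = c_i`: two decidable rational tests give `q₁ < θ*_i < q₂`; the tests
  have `ℚ` mirrors `lowerTest` / `upperTest` (`dblQ`, `cosLower5Q`, `cosUpper4Q` + cast lemmas), so that a
  whole node table `lo ≤ θ* ≤ hi` is certified by ONE `decide +kernel` (`RecastData.table_le_angleOf`,
  `angleOf_le_table`);
* per machine pair from per-machine tables `lo ≤ θ* ≤ hi` (NO per-line literals): `lineLo lo hi a b ≤
  |θ*_a − θ*_b| ≤ lineHi lo hi a b` (`lineLo = max(0, lo_a − hi_b, lo_b − hi_a)`, `lineHi = max(hi_a − lo_b,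
  hi_b − lo_a)`), while `sin`/`cos` of the line angle are the EXACT rationals `sd a b` / `cd a b`
  (`sd_cast`/`cd_cast` under `EqData`);
* the consumer inequalities, as rational functions of the data (`vtGapLo`, `eqTermHi`, pure-real versions
  `vtGap_ge_of_bounds`, `cos_add_mul_sin_le_of_bounds`, `sq_pi_sub_ge_of_bounds` with `π ∈ [3.1415, 3.1416]`
  from Mathlib's `pi_gt_d4`/`pi_lt_d4`):
  `vtGap(θ*_a − θ*_b) ≥ 2·cd − (3.1416 − 2·lineLo)·|sd|` and `cos δ* + δ* sin δ* ≤ cd + lineHi·|sd|`;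
  keyed versions for the line types of the LFF presentations (`LffLine`, `LffPair`).

With an instance's tables (`Models/NE39LAngles.lean`, WSCC9 block there) an explicit admissible level is one
rational inequality per line. CERTIFIED/VALIDATED/MODELLED: pure mathematics about the typed objects' exact
data; no model content, no stability claim.
-/

noncomputable section

open Real Set
open Literature.MathematicalPhysics.PowerSystems.ClassicalModel.LosslessSystem (vtGap)

namespace Summit.Ventures.GridStability.Models

/-! ### Pure real lemmas: `sin |x|`, `x sin x`, and the two monotone bounds -/

namespace AngleEnclosure

/-- `sin |x| = |sin x|` for `|x| ≤ π`. -/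
theorem sin_abs_eq_abs_sin {x : ℝ} (hx : |x| ≤ π) : sin |x| = |sin x| := by
  rcases le_or_gt 0 x with h | h
  · have hxπ : x ≤ π := by rwa [abs_of_nonneg h] at hx
    rw [abs_of_nonneg h, abs_of_nonneg (sin_nonneg_of_nonneg_of_le_pi h hxπ)]
  · have hx' : -π ≤ x := by rw [abs_of_neg h] at hx; linarith
    rw [abs_of_neg h, sin_neg, abs_of_nonpos (sin_nonpos_of_nonpos_of_neg_pi_le h.le hx')]

/-- `x · sin x = |x| · |sin x|` for `|x| ≤ π` (the product is even and nonnegative there). -/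
theorem mul_sin_eq_abs_mul_abs_sin {x : ℝ} (hx : |x| ≤ π) : x * sin x = |x| * |sin x| := by
  rcases le_or_gt 0 x with h | h
  · have hxπ : x ≤ π := by rwa [abs_of_nonneg h] at hx
    rw [abs_of_nonneg h, abs_of_nonneg (sin_nonneg_of_nonneg_of_le_pi h hxπ)]
  · have hx' : -π ≤ x := by rw [abs_of_neg h] at hx; linarith
    rw [abs_of_neg h, abs_of_nonpos (sin_nonpos_of_nonpos_of_neg_pi_le h.le hx')]
    ring

/-- `|sin x| ≤ |x|`. -/
theorem abs_sin_le_abs (x : ℝ) : |sin x| ≤ |x| := by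
  simpa using abs_sin_sub_sin_le x 0

/-- **Rational LOWER bound for the Vu–Turitsyn gap** `vtGap x = 2 cos x − (π − 2|x|) sin |x|`: with
`cos x = cd`, `|sin x| = as`, a lower bound `L ≤ |x|` and an upper bound `π ≤ P`:
`2·cd − (P − 2L)·as ≤ vtGap x` (`|x| ≤ π`). -/
theorem vtGap_ge_of_bounds {x cd as L P : ℝ} (hx : |x| ≤ π) (hcos : cos x = cd) (hsin : |sin x| = as)
    (hL : L ≤ |x|) (hP : π ≤ P) : 2 * cd - (P - 2 * L) * as ≤ vtGap x := by
  unfold vtGap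
  rw [sin_abs_eq_abs_sin hx, hsin, hcos]
  have has : 0 ≤ as := hsin ▸ abs_nonneg _
  nlinarith

/-- **Rational UPPER bound for the equilibrium term of `V(0)`**: with `cos x = cd`, `|sin x| = as` and
`|x| ≤ U`: `cos x + x sin x ≤ cd + U·as` (`|x| ≤ π`). -/
theorem cos_add_mul_sin_le_of_bounds {x cd as U : ℝ} (hx : |x| ≤ π) (hcos : cos x = cd)
    (hsin : |sin x| = as) (hU : |x| ≤ U) : cos x + x * sin x ≤ cd + U * as := by
  rw [mul_sin_eq_abs_mul_abs_sin hx, hsin, hcos]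
  have has : 0 ≤ as := hsin ▸ abs_nonneg _
  nlinarith

/-- **Rational LOWER bound for the face term of the gapQ level** `(π − 2|x|)²`: with `|x| ≤ U`, `P ≤ π`,
`2U ≤ P`: `(P − 2U)² ≤ (π − 2|x|)²`. -/
theorem sq_pi_sub_ge_of_bounds {x U P : ℝ} (hU : |x| ≤ U) (hP : P ≤ π) (h2 : 2 * U ≤ P) :
    (P - 2 * U) ^ 2 ≤ (π - 2 * |x|) ^ 2 :=
  pow_le_pow_left₀ (by linarith) (by linarith) 2

/-- `π ≤ 31416/10000` (Mathlib `pi_lt_d4`). -/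
theorem pi_le_31416 : π ≤ 31416 / 10000 := by
  have h := pi_lt_d4
  norm_num at h ⊢
  exact h.le

/-- `31415/10000 ≤ π` (Mathlib `pi_gt_d4`). -/
theorem pi_ge_31415 : (31415 : ℝ) / 10000 ≤ π := by
  have h := pi_gt_d4
  norm_num at h ⊢
  exact h.le

/-! ### Decidable rational mirrors of the chains (one `decide` per table) -/

/-- `ℚ` mirror of `dbl`. -/
def dblQ (v : ℚ) : ℚ := 2 * v ^ 2 - 1

/-- `ℚ` mirror of `cosLower5`. -/
def cosLower5Q (q : ℚ) : ℚ := dblQ (dblQ (dblQ (dblQ (dblQ (1 - (q / 32) ^ 2 / 2)))))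

/-- `ℚ` mirror of `cosUpper4`. -/
def cosUpper4Q (q : ℚ) : ℚ := dblQ (dblQ (dblQ (dblQ (1 - (q / 16) ^ 2 / 2 + (5 / 96) * (q / 16) ^ 4))))

/-- Cast of `dblQ`. -/
theorem cast_dblQ (v : ℚ) : ((dblQ v : ℚ) : ℝ) = dbl (v : ℝ) := by
  push_cast [dblQ, dbl]; ring

/-- Cast of `cosLower5Q`. -/
theorem cast_cosLower5Q (q : ℚ) : ((cosLower5Q q : ℚ) : ℝ) = cosLower5 (q : ℝ) := by
  rw [cosLower5Q, cast_dblQ, cast_dblQ, cast_dblQ, cast_dblQ, cast_dblQ, cosLower5]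
  push_cast; ring_nf

/-- Cast of `cosUpper4Q`. -/
theorem cast_cosUpper4Q (q : ℚ) : ((cosUpper4Q q : ℚ) : ℝ) = cosUpper4 (q : ℝ) := by
  rw [cosUpper4Q, cast_dblQ, cast_dblQ, cast_dblQ, cast_dblQ, cosUpper4]
  push_cast; ring_nf

/-- **Decidable LOWER-bound test** for an angle `x ∈ [0, π]` with `cos x = c`: `q ≤ 3`, the five side
conditions of the five-doubling chain at `q`, and `c < cosLower5Q q` — all over `ℚ`. -/
def lowerTest (c q : ℚ) : Bool :=
  decide (q ≤ 3) && decide (0 ≤ 1 - (q / 32) ^ 2 / 2) && decide (0 ≤ dblQ (1 - (q / 32) ^ 2 / 2))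
    && decide (0 ≤ dblQ (dblQ (1 - (q / 32) ^ 2 / 2)))
    && decide (0 ≤ dblQ (dblQ (dblQ (1 - (q / 32) ^ 2 / 2))))
    && decide (0 ≤ dblQ (dblQ (dblQ (dblQ (1 - (q / 32) ^ 2 / 2)))))
    && decide (c < cosLower5Q q)

/-- **Decidable UPPER-bound test**: `0 ≤ q ≤ 3` and `cosUpper4Q q < c`. -/
def upperTest (c q : ℚ) : Bool :=
  decide (0 ≤ q) && decide (q ≤ 3) && decide (cosUpper4Q q < c)

/-- Soundness of `lowerTest`: `0 ≤ x`, `cos x = c`, test passed ⇒ `q < x`. -/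
theorem angle_gt_of_lowerTest {x : ℝ} {c q : ℚ} (hx0 : 0 ≤ x) (hcos : cos x = (c : ℝ))
    (h : lowerTest c q = true) : (q : ℝ) < x := by
  simp only [lowerTest, Bool.and_eq_true, decide_eq_true_eq] at h
  obtain ⟨⟨⟨⟨⟨⟨hq3, h0⟩, h1⟩, h2⟩, h3⟩, h4⟩, hc⟩ := h
  have hqπ : (q : ℝ) ≤ π := by
    have : (q : ℝ) ≤ 3 := by exact_mod_cast hq3
    linarith [pi_gt_three]
  refine angle_gt_of_chain5 hx0 hqπ ?_ ?_ ?_ ?_ ?_ ?_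
  · have := (Rat.cast_le (K := ℝ)).mpr h0; push_cast at this; linarith
  · have := (Rat.cast_le (K := ℝ)).mpr h1; rw [Rat.cast_zero, cast_dblQ] at this; push_cast at this; exact this
  · have := (Rat.cast_le (K := ℝ)).mpr h2; rw [Rat.cast_zero, cast_dblQ, cast_dblQ] at this
    push_cast at this; exact this
  · have := (Rat.cast_le (K := ℝ)).mpr h3; rw [Rat.cast_zero, cast_dblQ, cast_dblQ, cast_dblQ] at this
    push_cast at this; exact this
  · have := (Rat.cast_le (K := ℝ)).mpr h4
    rw [Rat.cast_zero, cast_dblQ, cast_dblQ, cast_dblQ, cast_dblQ] at this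
    push_cast at this; exact this
  · have := (Rat.cast_lt (K := ℝ)).mpr hc; rw [cast_cosLower5Q] at this; rwa [hcos]

/-- Soundness of `upperTest`: `x ≤ π`, `cos x = c`, test passed ⇒ `x < q`. -/
theorem angle_lt_of_upperTest {x : ℝ} {c q : ℚ} (hxπ : x ≤ π) (hcos : cos x = (c : ℝ))
    (h : upperTest c q = true) : x < (q : ℝ) := by
  simp only [upperTest, Bool.and_eq_true, decide_eq_true_eq] at h
  obtain ⟨⟨hq0, hq3⟩, hc⟩ := h
  have hqπ : (q : ℝ) ≤ π := by
    have : (q : ℝ) ≤ 3 := by exact_mod_cast hq3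
    linarith [pi_gt_three]
  refine angle_lt_of_chain hxπ (by exact_mod_cast hq0) hqπ ?_
  have := (Rat.cast_lt (K := ℝ)).mpr hc; rw [cast_cosUpper4Q] at this; rwa [hcos]

/-! ### Line bounds from per-node tables (no per-line literals) -/

/-- Lower bound of `|θ_a − θ_b|` from node enclosures `lo ≤ θ ≤ hi`: `max(0, lo_a − hi_b, lo_b − hi_a)`. -/
def lineLo {m : ℕ} (lo hi : Fin m → ℚ) (a b : Fin m) : ℚ := max 0 (max (lo a - hi b) (lo b - hi a))

/-- Upper bound of `|θ_a − θ_b|` from node enclosures: `max(hi_a − lo_b, hi_b − lo_a)`. -/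
def lineHi {m : ℕ} (lo hi : Fin m → ℚ) (a b : Fin m) : ℚ := max (hi a - lo b) (hi b - lo a)

/-- `lineLo ≤ |θ_a − θ_b|`. -/
theorem lineLo_le_abs_sub {m : ℕ} {lo hi : Fin m → ℚ} {θ : Fin m → ℝ} (hlo : ∀ i, (lo i : ℝ) ≤ θ i)
    (hhi : ∀ i, θ i ≤ (hi i : ℝ)) (a b : Fin m) : ((lineLo lo hi a b : ℚ) : ℝ) ≤ |θ a - θ b| := by
  have h1 := hlo a; have h2 := hhi a; have h3 := hlo b; have h4 := hhi b
  push_cast [lineLo]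
  refine max_le (abs_nonneg _) (max_le ?_ ?_)
  · exact le_trans (by linarith) (le_abs_self (θ a - θ b))
  · exact le_trans (by linarith) (neg_le_abs (θ a - θ b))

/-- `|θ_a − θ_b| ≤ lineHi`. -/
theorem abs_sub_le_lineHi {m : ℕ} {lo hi : Fin m → ℚ} {θ : Fin m → ℝ} (hlo : ∀ i, (lo i : ℝ) ≤ θ i)
    (hhi : ∀ i, θ i ≤ (hi i : ℝ)) (a b : Fin m) : |θ a - θ b| ≤ ((lineHi lo hi a b : ℚ) : ℝ) := by
  have h1 := hlo a; have h2 := hhi a; have h3 := hlo b; have h4 := hhi b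
  push_cast [lineHi]
  rw [abs_sub_le_iff]
  exact ⟨le_trans (by linarith) (le_max_left _ _), le_trans (by linarith) (le_max_right _ _)⟩

end AngleEnclosure

open AngleEnclosure

namespace RecastData

variable {n : ℕ} (d : RecastData n)

/-! ### Per machine: `angleOf` facts and the certified enclosure tests -/

/-- `angleOf i = arccos c_i` when `s_i ≥ 0`. -/
theorem angleOf_of_nonneg {i : Fin (n + 1)} (hs : 0 ≤ d.s i) : d.angleOf i = arccos (d.c i : ℝ) := by
  unfold angleOf; rw [if_pos hs]

/-- `0 ≤ angleOf i` when `s_i ≥ 0`. -/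
theorem angleOf_nonneg {i : Fin (n + 1)} (hs : 0 ≤ d.s i) : 0 ≤ d.angleOf i := by
  rw [d.angleOf_of_nonneg hs]; exact arccos_nonneg _

/-- `|angleOf i| ≤ π` always. -/
theorem abs_angleOf_le_pi (i : Fin (n + 1)) : |d.angleOf i| ≤ π := by
  unfold angleOf
  split_ifs
  · rw [abs_of_nonneg (arccos_nonneg _)]; exact arccos_le_pi _
  · rw [abs_neg, abs_of_nonneg (arccos_nonneg _)]; exact arccos_le_pi _

/-- `|angleOf i| < π/2` for an acute circle point (`c_i > 0`). -/
theorem abs_angleOf_lt_pi_div_two {i : Fin (n + 1)} (hc : 0 < d.c i) : |d.angleOf i| < π / 2 := by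
  have h : arccos (d.c i : ℝ) < π / 2 := arccos_lt_pi_div_two.2 (by exact_mod_cast hc)
  unfold angleOf
  split_ifs
  · rwa [abs_of_nonneg (arccos_nonneg _)]
  · rwa [abs_neg, abs_of_nonneg (arccos_nonneg _)]

/-- The reference (or any node with `s_i ≥ 0`, `c_i = 1`) has angle `0`. -/
theorem angleOf_eq_zero {i : Fin (n + 1)} (hs : 0 ≤ d.s i) (hc : d.c i = 1) : d.angleOf i = 0 := by
  rw [d.angleOf_of_nonneg hs, hc]; push_cast; exact arccos_one

/-- Acute circle points give line angles in `(−π, π)`. -/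
theorem abs_angleOf_sub_lt_pi {a b : Fin (n + 1)} (ha : 0 < d.c a) (hb : 0 < d.c b) :
    |d.angleOf a - d.angleOf b| < π := by
  have h1 := d.abs_angleOf_lt_pi_div_two ha
  have h2 := d.abs_angleOf_lt_pi_div_two hb
  rw [abs_lt] at h1 h2 ⊢
  constructor <;> linarith

/-- Acute circle points give line angles in the Vu–Turitsyn window `(−π/2, π/2)` whenever both node
angles have the same sign — here: all `s ≥ 0`. -/
theorem abs_angleOf_sub_lt_pi_div_two {a b : Fin (n + 1)} (hsa : 0 ≤ d.s a) (hsb : 0 ≤ d.s b)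
    (ha : 0 < d.c a) (hb : 0 < d.c b) : |d.angleOf a - d.angleOf b| < π / 2 := by
  have h1 := d.abs_angleOf_lt_pi_div_two ha
  have h2 := d.abs_angleOf_lt_pi_div_two hb
  have p1 := d.angleOf_nonneg hsa
  have p2 := d.angleOf_nonneg hsb
  rw [abs_lt] at h1 h2 ⊢
  constructor <;> linarith

/-- **Certified rational LOWER bound of a node angle** (five-doubling chain on `cos θ*_i = c_i`): the
side conditions and the test `c_i < cosLower5 q` are decidable rational facts. -/
theorem angleOf_gt_of_chain5 {i : Fin (n + 1)} (hcirc : d.s i ^ 2 + d.c i ^ 2 = 1) (hs : 0 ≤ d.s i)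
    {q : ℝ} (hqπ : q ≤ π)
    (h0 : 0 ≤ 1 - (q / 32) ^ 2 / 2) (h1 : 0 ≤ dbl (1 - (q / 32) ^ 2 / 2))
    (h2 : 0 ≤ dbl (dbl (1 - (q / 32) ^ 2 / 2))) (h3 : 0 ≤ dbl (dbl (dbl (1 - (q / 32) ^ 2 / 2))))
    (h4 : 0 ≤ dbl (dbl (dbl (dbl (1 - (q / 32) ^ 2 / 2)))))
    (h : (d.c i : ℝ) < cosLower5 q) : q < d.angleOf i :=
  angle_gt_of_chain5 (d.angleOf_nonneg hs) hqπ h0 h1 h2 h3 h4 (by rwa [d.cos_angleOf hcirc])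

/-- **Certified rational UPPER bound of a node angle** (four-doubling upper chain): the test
`cosUpper4 q < c_i` is a decidable rational fact. -/
theorem angleOf_lt_of_chain {i : Fin (n + 1)} (hcirc : d.s i ^ 2 + d.c i ^ 2 = 1) {q : ℝ}
    (hq0 : 0 ≤ q) (hqπ : q ≤ π) (h : cosUpper4 q < (d.c i : ℝ)) : d.angleOf i < q :=
  angle_lt_of_chain ((le_abs_self _).trans (d.abs_angleOf_le_pi i)) hq0 hqπ
    (by rwa [d.cos_angleOf hcirc])

/-- **A whole LOWER node table in one `decide`**: for data with exact circle points and all `s_i ≥ 0`,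
a rational table `lo` each of whose entries is `≤ 0` or passes `lowerTest (c_i) (lo_i)` bounds the node
angles from below. -/
theorem table_le_angleOf (hcirc : ∀ i, d.s i ^ 2 + d.c i ^ 2 = 1) (hs : ∀ i, 0 ≤ d.s i)
    (lo : Fin (n + 1) → ℚ) (h : ∀ i, lo i ≤ 0 ∨ lowerTest (d.c i) (lo i) = true) (i : Fin (n + 1)) :
    ((lo i : ℚ) : ℝ) ≤ d.angleOf i := by
  rcases h i with hle | ht
  · exact le_trans (by exact_mod_cast hle) (d.angleOf_nonneg (hs i))
  · exact (angle_gt_of_lowerTest (d.angleOf_nonneg (hs i)) (d.cos_angleOf (hcirc i)) ht).le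

/-- **A whole UPPER node table in one `decide`**: each entry either dominates a node with `c_i = 1`
(angle `0`; needs `s_i ≥ 0`, `0 ≤ hi_i`) or passes `upperTest (c_i) (hi_i)`. -/
theorem angleOf_le_table (hcirc : ∀ i, d.s i ^ 2 + d.c i ^ 2 = 1) (hs : ∀ i, 0 ≤ d.s i)
    (hi : Fin (n + 1) → ℚ) (h : ∀ i, (d.c i = 1 ∧ 0 ≤ hi i) ∨ upperTest (d.c i) (hi i) = true)
    (i : Fin (n + 1)) : d.angleOf i ≤ ((hi i : ℚ) : ℝ) := by
  rcases h i with ⟨hc1, hle⟩ | ht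
  · rw [d.angleOf_eq_zero (hs i) hc1]; exact_mod_cast hle
  · exact (angle_lt_of_upperTest ((le_abs_self _).trans (d.abs_angleOf_le_pi i))
      (d.cos_angleOf (hcirc i)) ht).le

/-! ### Per line: exact `sin`/`cos`, enclosure of `|δ*|`, and the two rational consumer bounds -/

/-- `cos(θ*_a − θ*_b) = cd a b` for the angles `angleOf` (exact rational). -/
theorem cos_angleOf_sub (hE : d.EqData d.angleOf) (a b : Fin (n + 1)) :
    cos (d.angleOf a - d.angleOf b) = (d.cd a b : ℝ) := (d.cd_cast hE a b).symm

/-- `|sin(θ*_a − θ*_b)| = |sd a b|` for the angles `angleOf` (exact rational). -/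
theorem abs_sin_angleOf_sub (hE : d.EqData d.angleOf) (a b : Fin (n + 1)) :
    |sin (d.angleOf a - d.angleOf b)| = ((|d.sd a b| : ℚ) : ℝ) := by
  rw [Rat.cast_abs, d.sd_cast hE a b]

/-- Rational lower bound of `vtGap(θ*_a − θ*_b)` from node tables: `2·cd − (3.1416 − 2·lineLo)·|sd|`. -/
def vtGapLo (lo hi : Fin (n + 1) → ℚ) (a b : Fin (n + 1)) : ℚ :=
  2 * d.cd a b - (31416 / 10000 - 2 * lineLo lo hi a b) * |d.sd a b|

/-- Rational upper bound of the equilibrium term `cos δ* + δ* sin δ*` of `V(0)`: `cd + lineHi·|sd|`. -/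
def eqTermHi (lo hi : Fin (n + 1) → ℚ) (a b : Fin (n + 1)) : ℚ :=
  d.cd a b + lineHi lo hi a b * |d.sd a b|

/-- **`vtGapLo ≤ vtGap(θ*_a − θ*_b)`** for acute exact data and certified node tables. -/
theorem vtGapLo_le (hE : d.EqData d.angleOf) (hc : ∀ i, 0 < d.c i) {lo hi : Fin (n + 1) → ℚ}
    (hlo : ∀ i, (lo i : ℝ) ≤ d.angleOf i) (hhi : ∀ i, d.angleOf i ≤ (hi i : ℝ)) (a b : Fin (n + 1)) :
    ((d.vtGapLo lo hi a b : ℚ) : ℝ) ≤ vtGap (d.angleOf a - d.angleOf b) := by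
  have key := vtGap_ge_of_bounds (d.abs_angleOf_sub_lt_pi (hc a) (hc b)).le (d.cos_angleOf_sub hE a b)
    (d.abs_sin_angleOf_sub hE a b) (lineLo_le_abs_sub hlo hhi a b) pi_le_31416
  push_cast [vtGapLo] at key ⊢
  linarith

/-- **`cos δ* + δ* sin δ* ≤ eqTermHi`** (`δ* = θ*_a − θ*_b`) for acute exact data and node tables. -/
theorem cos_add_mul_sin_le_eqTermHi (hE : d.EqData d.angleOf) (hc : ∀ i, 0 < d.c i)
    {lo hi : Fin (n + 1) → ℚ} (hlo : ∀ i, (lo i : ℝ) ≤ d.angleOf i) (hhi : ∀ i, d.angleOf i ≤ (hi i : ℝ))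
    (a b : Fin (n + 1)) :
    cos (d.angleOf a - d.angleOf b) + (d.angleOf a - d.angleOf b) * sin (d.angleOf a - d.angleOf b)
      ≤ ((d.eqTermHi lo hi a b : ℚ) : ℝ) := by
  have key := cos_add_mul_sin_le_of_bounds (d.abs_angleOf_sub_lt_pi (hc a) (hc b)).le
    (d.cos_angleOf_sub hE a b) (d.abs_sin_angleOf_sub hE a b) (abs_sub_le_lineHi hlo hhi a b)
  push_cast [eqTermHi] at key ⊢
  linarith

/-- **Face term**: `(3.1415 − 2·lineHi)² ≤ (π − 2|θ*_a − θ*_b|)²` whenever `2·lineHi ≤ 3.1415`. -/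
theorem sq_pi_sub_ge {lo hi : Fin (n + 1) → ℚ} (hlo : ∀ i, (lo i : ℝ) ≤ d.angleOf i)
    (hhi : ∀ i, d.angleOf i ≤ (hi i : ℝ)) (a b : Fin (n + 1)) (h2 : 2 * lineHi lo hi a b ≤ 31415 / 10000) :
    (((31415 / 10000 - 2 * lineHi lo hi a b) ^ 2 : ℚ) : ℝ) ≤ (π - 2 * |d.angleOf a - d.angleOf b|) ^ 2 := by
  have h2' : 2 * ((lineHi lo hi a b : ℚ) : ℝ) ≤ 31415 / 10000 := by
    have := (Rat.cast_le (K := ℝ)).mpr h2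
    push_cast at this
    linarith
  have key := sq_pi_sub_ge_of_bounds (abs_sub_le_lineHi hlo hhi a b) pi_ge_31415 h2'
  push_cast at key ⊢
  exact key

/-! ### Keyed by the line types of the LFF presentations -/

/-- Unordered lines (`lffSystemU`): `vtGapLo ≤ vtGap(δ*_k)`. -/
theorem vtGapLo_le_line (hE : d.EqData d.angleOf) (hc : ∀ i, 0 < d.c i) {lo hi : Fin (n + 1) → ℚ}
    (hlo : ∀ i, (lo i : ℝ) ≤ d.angleOf i) (hhi : ∀ i, d.angleOf i ≤ (hi i : ℝ)) (k : LffLine n) :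
    ((d.vtGapLo lo hi k.1.1 k.1.2 : ℚ) : ℝ) ≤ vtGap (lffδsu d.angleOf k) :=
  d.vtGapLo_le hE hc hlo hhi k.1.1 k.1.2

/-- Unordered lines: the `V(0)` term bound. -/
theorem eqTerm_le_line (hE : d.EqData d.angleOf) (hc : ∀ i, 0 < d.c i) {lo hi : Fin (n + 1) → ℚ}
    (hlo : ∀ i, (lo i : ℝ) ≤ d.angleOf i) (hhi : ∀ i, d.angleOf i ≤ (hi i : ℝ)) (k : LffLine n) :
    cos (lffδsu d.angleOf k) + lffδsu d.angleOf k * sin (lffδsu d.angleOf k)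
      ≤ ((d.eqTermHi lo hi k.1.1 k.1.2 : ℚ) : ℝ) :=
  d.cos_add_mul_sin_le_eqTermHi hE hc hlo hhi k.1.1 k.1.2

/-- Ordered off-diagonal pairs (`lffSystemOff`): `vtGapLo ≤ vtGap(δ*_k)`. -/
theorem vtGapLo_le_pair (hE : d.EqData d.angleOf) (hc : ∀ i, 0 < d.c i) {lo hi : Fin (n + 1) → ℚ}
    (hlo : ∀ i, (lo i : ℝ) ≤ d.angleOf i) (hhi : ∀ i, d.angleOf i ≤ (hi i : ℝ)) (k : LffPair n) :
    ((d.vtGapLo lo hi k.1.1 k.1.2 : ℚ) : ℝ) ≤ vtGap (lffδso d.angleOf k) :=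
  d.vtGapLo_le hE hc hlo hhi k.1.1 k.1.2

/-- Ordered off-diagonal pairs: the `V(0)` term bound. -/
theorem eqTerm_le_pair (hE : d.EqData d.angleOf) (hc : ∀ i, 0 < d.c i) {lo hi : Fin (n + 1) → ℚ}
    (hlo : ∀ i, (lo i : ℝ) ≤ d.angleOf i) (hhi : ∀ i, d.angleOf i ≤ (hi i : ℝ)) (k : LffPair n) :
    cos (lffδso d.angleOf k) + lffδso d.angleOf k * sin (lffδso d.angleOf k)
      ≤ ((d.eqTermHi lo hi k.1.1 k.1.2 : ℚ) : ℝ) :=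
  d.cos_add_mul_sin_le_eqTermHi hE hc hlo hhi k.1.1 k.1.2

/-- **Weighted sums** (the shape of `−V(0)/c′` for the closed forms `K = c′·w`): for nonnegative rational
weights `w`, `Σ_k w_k (cos δ*_k + δ*_k sin δ*_k) ≤ Σ_k w_k · eqTermHi_k` over the unordered lines — the
right side is a rational number (`decide`). -/
theorem sum_w_eqTerm_le_line (hE : d.EqData d.angleOf) (hc : ∀ i, 0 < d.c i) {lo hi : Fin (n + 1) → ℚ}
    (hlo : ∀ i, (lo i : ℝ) ≤ d.angleOf i) (hhi : ∀ i, d.angleOf i ≤ (hi i : ℝ))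
    (w : LffLine n → ℚ) (hw : ∀ k, 0 ≤ w k) :
    ∑ k : LffLine n, (w k : ℝ) * (cos (lffδsu d.angleOf k) + lffδsu d.angleOf k * sin (lffδsu d.angleOf k))
      ≤ ((∑ k : LffLine n, w k * d.eqTermHi lo hi k.1.1 k.1.2 : ℚ) : ℝ) := by
  push_cast
  exact Finset.sum_le_sum fun k _ =>
    mul_le_mul_of_nonneg_left (d.eqTerm_le_line hE hc hlo hhi k) (by exact_mod_cast hw k)

/-- Weighted sums over the ordered off-diagonal pairs. -/
theorem sum_w_eqTerm_le_pair (hE : d.EqData d.angleOf) (hc : ∀ i, 0 < d.c i) {lo hi : Fin (n + 1) → ℚ}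
    (hlo : ∀ i, (lo i : ℝ) ≤ d.angleOf i) (hhi : ∀ i, d.angleOf i ≤ (hi i : ℝ))
    (w : LffPair n → ℚ) (hw : ∀ k, 0 ≤ w k) :
    ∑ k : LffPair n, (w k : ℝ) * (cos (lffδso d.angleOf k) + lffδso d.angleOf k * sin (lffδso d.angleOf k))
      ≤ ((∑ k : LffPair n, w k * d.eqTermHi lo hi k.1.1 k.1.2 : ℚ) : ℝ) := by
  push_cast
  exact Finset.sum_le_sum fun k _ =>
    mul_le_mul_of_nonneg_left (d.eqTerm_le_pair hE hc hlo hhi k) (by exact_mod_cast hw k)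

end RecastData

end Summit.Ventures.GridStability.Models

end
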